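import Mathlib
import HarnessLib
import Summits.NavierStokesRegularity.NavierStokesRegularity.Theorems.TypeIQuarterGateScarEnvelopeTypeIForcedTsaiEnclosures
import Summits.NavierStokesRegularity.NavierStokesRegularity.Theorems.TypeIQuarterGateScarEnvelopeTypeIForcedTsaiFieldDivFree
import Summits.NavierStokesRegularity.NavierStokesRegularity.Theorems.TypeIQuarterGateScarEnvelopeTypeIForcedTsaiFieldResidual
import Summits.NavierStokesRegularity.NavierStokesRegularity.Theorems.TypeIQuarterGateScarEnvelopeTypeIForcedTsaiMoments

/-!
# ARM B lane E-exact — SOUNDNESS of the witness rows: `WitnessRow.check = true → ForcedTsaiModulusLE M δ`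

The kernel soundness theorem of the tree checker `…ForcedTsaiCert` (ns-wall-extremal PREREG-WALL-1 A1
§B2(d), exp-lead «E-exact GO»): a passing `WitnessRow` CERTIFIES `ForcedTsaiModulusLE M δ` — there is an
explicit smooth divergence-free field (the witness `U = e^{−a|y|²}·curl_a p`) with
`‖curl U‖_{L²(B₁₀)} ≥ M` whose weighted vorticity residual `‖(1+ρ)^{5/2} g‖_{L²}` of the steady backward
Leray operator is `≤ δ`.  Assembled from: `…ForcedTsaiFieldDivFree` (smooth, div-free),
`…ForcedTsaiFieldCalculus` (`curl U = e^{−a|y|²}·ω`), `…ForcedTsaiFieldResidual`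
(`g = e^{−a|y|²}·g₁ + e^{−2a|y|²}·g₂`), `…ForcedTsaiMoments` (the `ℝ³` Gaussian-moment identity behind
`pairVec`), `…ForcedTsaiEnclosures` (rational enclosures), and the glue below (level via
`𝟙_{B₁₀} ≥ 1 − ρ²/100`, residual via the even majorant `(1+ρ)⁵ ≤ m(ρ²)` and the three-term moment split,
sign-aware enclosure step incl. the product bound for a negative cross term).

MEANING (fixed by the exp-lead for RESULTS-WALL-1): an UPPER bound on the forced-Tsai modulus — «near-
profiles with residual this small EXIST»; never an exclusion.  Nothing here bears on NS regularity;
crux `ScarEnvelopeTypeI` (stmt-23843) and wall H3 are OPEN.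
-/

noncomputable section

set_option linter.dupNamespace false

namespace Summit.NavierStokesRegularity.NavierStokesRegularity.Cruxes.ScarEnvelopeTypeI.ForcedTsai

open MeasureTheory Set Metric Real
open scoped RealInnerProductSpace ContDiff
open Literature.Analysis.FluidPDE

/-! ## Proved glue: the rate algebra -/

namespace WitnessRow

/-- Rate algebra: `(π/(k·a))^{3/2} = π^{3/2} · k^{−3/2} / s³` for `a = s²`, `s > 0`, `k > 0`. -/
theorem rate_rpow (r : WitnessRow) (hs : 0 < (r.s : ℝ)) {k : ℝ} (hk : 0 < k) :
    (Real.pi / (k * r.aR)) ^ (3 / 2 : ℝ) = Real.pi ^ (3 / 2 : ℝ) * k ^ (-(3 / 2 : ℝ)) / (r.s : ℝ) ^ 3 := by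
  have ha : 0 < r.aR := by unfold aR; positivity
  rw [Real.div_rpow Real.pi_pos.le (by positivity), Real.mul_rpow hk.le ha.le, Real.rpow_neg hk.le]
  have h3 : r.aR ^ (3 / 2 : ℝ) = (r.s : ℝ) ^ 3 := by
    unfold aR
    rw [← Real.rpow_natCast (r.s : ℝ) 2, ← Real.rpow_mul hs.le]
    norm_num
  rw [h3]
  field_simp

end WitnessRow

/-! ## The soundness theorem -/

set_option maxHeartbeats 800000 in
/-- **SOUNDNESS of an E-exact witness row**: a passing row certifies
`ForcedTsaiModulusLE M δ` — an upper bound on the forced-Tsai modulus. -/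
theorem WitnessRow.sound (r : WitnessRow) (h : r.check = true) :
    ForcedTsaiModulusLE (r.M : ℝ) (r.δ : ℝ) := by
  simp only [WitnessRow.check, Bool.and_eq_true, decide_eq_true_eq] at h
  obtain ⟨⟨⟨⟨hs, hM⟩, hδ⟩, hlev⟩, hres⟩ := h
  obtain ⟨hsmooth, hdiv⟩ := r.field_smooth_divFree
  obtain ⟨hpiL, hpiH, hc2L, hc2H, hc3L, hc3H, hprod⟩ := enclosures_hold
  have hs' : (0 : ℝ) < r.s := by exact_mod_cast hs
  have hM' : (0 : ℝ) ≤ r.M := by exact_mod_cast hM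
  have hδ' : (0 : ℝ) ≤ r.δ := by exact_mod_cast hδ
  have ha : 0 < r.a := by unfold WitnessRow.a; exact mul_pos hs hs
  have haR : (r.a : ℝ) = r.aR := by unfold WitnessRow.a WitnessRow.aR; push_cast; ring
  have hpi32 : 0 ≤ Real.pi ^ (3 / 2 : ℝ) := by positivity
  -- the three Gaussian-moment packages
  have h2a : (0 : ℚ) < 2 * r.a := by positivity
  have h3a : (0 : ℚ) < 3 * r.a := by positivity
  have h4a : (0 : ℚ) < 4 * r.a := by positivity
  obtain ⟨hintL, hIL⟩ := moment_pairVec wLevel r.om r.om h2a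
  obtain ⟨hint1, hI1⟩ := moment_pairVec [⟨0, 0, 0, 1⟩] r.om r.om h2a
  obtain ⟨hint2, hI2⟩ := moment_pairVec wResid r.g1 r.g1 h2a
  obtain ⟨hint3, hI3⟩ := moment_pairVec wResid r.g1 r.g2 h3a
  obtain ⟨hint4, hI4⟩ := moment_pairVec wResid r.g2 r.g2 h4a
  -- casts of the rates
  have c2a : ((2 * r.a : ℚ) : ℝ) = 2 * r.aR := by push_cast; rw [haR]
  have c3a : ((3 * r.a : ℚ) : ℝ) = 3 * r.aR := by push_cast; rw [haR]
  have c4a : ((4 * r.a : ℚ) : ℝ) = 4 * r.aR := by push_cast; rw [haR]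
  -- ‖curl U‖² pointwise
  have hcurl : ∀ y, ‖curl r.field y‖ ^ 2 = ⟪evalVec r.om y, evalVec r.om y⟫ * gauss (2 * r.aR) y := by
    intro y
    have e2 : gauss r.aR y * gauss r.aR y = gauss (2 * r.aR) y := by rw [gauss_mul]; ring_nf
    rw [r.curl_field y, norm_smul, mul_pow, Real.norm_eq_abs, sq_abs, real_inner_self_eq_norm_sq,
      sq (gauss r.aR y), e2]
    ring
  -- the residual pointwise
  have hresid : ∀ y, ‖lerayVorticityResidual r.field y‖ ^ 2 =
      ⟪evalVec r.g1 y, evalVec r.g1 y⟫ * gauss (2 * r.aR) y +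
        2 * (⟪evalVec r.g1 y, evalVec r.g2 y⟫ * gauss (3 * r.aR) y) +
        ⟪evalVec r.g2 y, evalVec r.g2 y⟫ * gauss (4 * r.aR) y := by
    intro y
    rw [r.vorticityResidual_field y, ← real_inner_self_eq_norm_sq]
    have e2 : gauss r.aR y * gauss r.aR y = gauss (2 * r.aR) y := by rw [gauss_mul]; ring_nf
    have e3 : gauss r.aR y * gauss (2 * r.aR) y = gauss (3 * r.aR) y := by rw [gauss_mul]; ring_nf
    have e4 : gauss (2 * r.aR) y * gauss (2 * r.aR) y = gauss (4 * r.aR) y := by rw [gauss_mul]; ring_nf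
    rw [← e4, ← e3]
    simp only [inner_add_left, inner_add_right, real_inner_smul_left, real_inner_smul_right]
    rw [real_inner_comm (evalVec r.g1 y) (evalVec r.g2 y), ← e2]
    ring
  refine ⟨r.field, hsmooth, hdiv, ?_, ?_, ?_⟩
  · -- LEVEL
    unfold lerayLevel
    refine (Real.le_sqrt hM' (integral_nonneg fun y => sq_nonneg _)).mpr ?_
    -- ∫_{B₁₀} ‖curl U‖² ≥ ∫ wLevel·‖curl U‖² = R_L (π/2a)^{3/2}
    have hind : Integrable (fun y => ‖curl r.field y‖ ^ 2) := by
      have : (fun y => ‖curl r.field y‖ ^ 2) =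
          fun y => QPoly.eval [⟨0, 0, 0, 1⟩] y * ⟪evalVec r.om y, evalVec r.om y⟫ * gauss ((2 * r.a : ℚ) : ℝ) y := by
        funext y; rw [hcurl y, eval_one, c2a]; ring
      rw [this]; exact hint1
    have hmono : ∫ y, QPoly.eval wLevel y * ⟪evalVec r.om y, evalVec r.om y⟫ * gauss ((2 * r.a : ℚ) : ℝ) y ≤
        ∫ y in ball (0 : E3) 10, ‖curl r.field y‖ ^ 2 := by
      rw [← integral_indicator measurableSet_ball]
      refine integral_mono hintL (hind.indicator measurableSet_ball) fun y => ?_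
      have hQ : 0 ≤ ⟪evalVec r.om y, evalVec r.om y⟫ * gauss ((2 * r.a : ℚ) : ℝ) y := by
        rw [real_inner_self_eq_norm_sq]; exact mul_nonneg (sq_nonneg _) (gauss_pos _ _).le
      by_cases hy : y ∈ ball (0 : E3) 10
      · rw [indicator_of_mem hy, hcurl y, ← c2a, eval_wLevel]
        have hw : 1 - ‖y‖ ^ 2 / 100 ≤ 1 := by linarith [sq_nonneg ‖y‖]
        nlinarith
      · rw [indicator_of_notMem hy, eval_wLevel]
        have hy' : 10 ≤ ‖y‖ := by simpa [mem_ball, dist_zero_right] using hy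
        have hw : 1 - ‖y‖ ^ 2 / 100 ≤ 0 := by nlinarith
        rw [mul_assoc]
        exact mul_nonpos_of_nonpos_of_nonneg hw hQ
    have hlev' : (r.M : ℝ) ^ 2 ≤ (r.lev2Lo : ℝ) := by
      have := hlev; rw [← sq] at this; exact_mod_cast this
    unfold WitnessRow.lev2Lo at hlev'
    split_ifs at hlev' with hRL
    · have hRL' : (0 : ℝ) ≤ r.RL := by exact_mod_cast hRL
      push_cast at hlev'
      refine hlev'.trans (le_trans ?_ hmono)
      rw [hIL, c2a, r.rate_rpow hs' (by norm_num : (0 : ℝ) < 2),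
        show (pairVec wLevel r.om r.om (2 * r.a) : ℚ) = r.RL from rfl]
      have hs3 : (0 : ℝ) < (r.s : ℝ) ^ 3 := by positivity
      rw [show (r.RL : ℝ) * (Real.pi ^ (3 / 2 : ℝ) * (2 : ℝ) ^ (-(3 / 2 : ℝ)) / (r.s : ℝ) ^ 3) =
        (r.RL : ℝ) * (Real.pi ^ (3 / 2 : ℝ) * (2 : ℝ) ^ (-(3 / 2 : ℝ))) / (r.s : ℝ) ^ 3 by ring,
        show (r.RL : ℝ) * (pi32Lo : ℝ) * (c2Lo : ℝ) / (r.s : ℝ) ^ 3 =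
        (r.RL : ℝ) * ((pi32Lo : ℝ) * (c2Lo : ℝ)) / (r.s : ℝ) ^ 3 by ring]
      refine div_le_div_of_nonneg_right (mul_le_mul_of_nonneg_left ?_ hRL') hs3.le
      exact mul_le_mul hpiL hc2L (by norm_num [c2Lo]) hpi32
    · push_cast at hlev'
      exact hlev'.trans (integral_nonneg fun y => sq_nonneg _)
  · -- INTEGRABILITY of (1+ρ)⁵ |g|²
    have hΨ : Integrable (fun y =>
        QPoly.eval wResid y * ⟪evalVec r.g1 y, evalVec r.g1 y⟫ * gauss ((2 * r.a : ℚ) : ℝ) y +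
        2 * (QPoly.eval wResid y * ⟪evalVec r.g1 y, evalVec r.g2 y⟫ * gauss ((3 * r.a : ℚ) : ℝ) y) +
        QPoly.eval wResid y * ⟪evalVec r.g2 y, evalVec r.g2 y⟫ * gauss ((4 * r.a : ℚ) : ℝ) y) :=
      (hint2.add (hint3.const_mul 2)).add hint4
    refine hΨ.mono' ?_ (Filter.Eventually.of_forall fun y => ?_)
    · have hc : Continuous fun y => (1 + ‖y‖) ^ 5 * ‖lerayVorticityResidual r.field y‖ ^ 2 := by
        have : (fun y => (1 + ‖y‖) ^ 5 * ‖lerayVorticityResidual r.field y‖ ^ 2) = fun y =>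
            (1 + ‖y‖) ^ 5 * ‖gauss r.aR y • evalVec r.g1 y + gauss (2 * r.aR) y • evalVec r.g2 y‖ ^ 2 := by
          funext y; rw [r.vorticityResidual_field y]
        rw [this]
        exact ((continuous_const.add continuous_norm).pow 5).mul
          ((((continuous_gauss _).smul (continuous_evalVec _)).add
            ((continuous_gauss _).smul (continuous_evalVec _))).norm.pow 2)
      exact hc.aestronglyMeasurable
    · rw [Real.norm_eq_abs, abs_of_nonneg (by positivity), hresid y, c2a, c3a, c4a, eval_wResid]
      have hQ : 0 ≤ ⟪evalVec r.g1 y, evalVec r.g1 y⟫ * gauss (2 * r.aR) y +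
          2 * (⟪evalVec r.g1 y, evalVec r.g2 y⟫ * gauss (3 * r.aR) y) +
          ⟪evalVec r.g2 y, evalVec r.g2 y⟫ * gauss (4 * r.aR) y := by
        rw [← hresid y]; positivity
      have hm := pow_five_le_m ‖y‖
      have key := mul_le_mul_of_nonneg_right hm hQ
      linarith [key]
  · -- RESIDUAL
    unfold lerayResidualNorm
    rw [show (r.δ : ℝ) = Real.sqrt ((r.δ : ℝ) ^ 2) by rw [Real.sqrt_sq hδ']]
    refine Real.sqrt_le_sqrt ?_
    have hΨ : Integrable (fun y =>
        QPoly.eval wResid y * ⟪evalVec r.g1 y, evalVec r.g1 y⟫ * gauss ((2 * r.a : ℚ) : ℝ) y +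
        2 * (QPoly.eval wResid y * ⟪evalVec r.g1 y, evalVec r.g2 y⟫ * gauss ((3 * r.a : ℚ) : ℝ) y) +
        QPoly.eval wResid y * ⟪evalVec r.g2 y, evalVec r.g2 y⟫ * gauss ((4 * r.a : ℚ) : ℝ) y) :=
      (hint2.add (hint3.const_mul 2)).add hint4
    have hstep : ∫ y, (1 + ‖y‖) ^ 5 * ‖lerayVorticityResidual r.field y‖ ^ 2 ≤
        ∫ y, (QPoly.eval wResid y * ⟪evalVec r.g1 y, evalVec r.g1 y⟫ * gauss ((2 * r.a : ℚ) : ℝ) y +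
          2 * (QPoly.eval wResid y * ⟪evalVec r.g1 y, evalVec r.g2 y⟫ * gauss ((3 * r.a : ℚ) : ℝ) y) +
          QPoly.eval wResid y * ⟪evalVec r.g2 y, evalVec r.g2 y⟫ * gauss ((4 * r.a : ℚ) : ℝ) y) := by
      refine integral_mono_of_nonneg (Filter.Eventually.of_forall fun y => by positivity) hΨ
        (Filter.Eventually.of_forall fun y => ?_)
      beta_reduce
      rw [hresid y, c2a, c3a, c4a, eval_wResid]
      have hQ : 0 ≤ ⟪evalVec r.g1 y, evalVec r.g1 y⟫ * gauss (2 * r.aR) y +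
          2 * (⟪evalVec r.g1 y, evalVec r.g2 y⟫ * gauss (3 * r.aR) y) +
          ⟪evalVec r.g2 y, evalVec r.g2 y⟫ * gauss (4 * r.aR) y := by
        rw [← hresid y]; positivity
      have hm := pow_five_le_m ‖y‖
      have key := mul_le_mul_of_nonneg_right hm hQ
      linarith [key]
    refine hstep.trans ?_
    have hi12 : Integrable (fun y =>
        QPoly.eval wResid y * ⟪evalVec r.g1 y, evalVec r.g1 y⟫ * gauss ((2 * r.a : ℚ) : ℝ) y +
        2 * (QPoly.eval wResid y * ⟪evalVec r.g1 y, evalVec r.g2 y⟫ * gauss ((3 * r.a : ℚ) : ℝ) y)) :=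
      hint2.add (hint3.const_mul 2)
    rw [integral_add hi12 hint4, integral_add hint2 (hint3.const_mul 2),
      integral_const_mul, hI2, hI3, hI4, c2a, c3a, c4a,
      r.rate_rpow hs' (by norm_num : (0 : ℝ) < 2), r.rate_rpow hs' (by norm_num : (0 : ℝ) < 3),
      r.rate_rpow hs' (by norm_num : (0 : ℝ) < 4),
      show pairVec wResid r.g1 r.g1 (2 * r.a) = r.R2 from rfl, show pairVec wResid r.g2 r.g2 (4 * r.a) = r.R4 from rfl]
    -- ≤ res2Hi ≤ δ²
    have hres' : (r.res2Hi : ℝ) ≤ (r.δ : ℝ) ^ 2 := by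
      have := hres; rw [← sq] at this; exact_mod_cast this
    refine le_trans ?_ hres'
    unfold WitnessRow.res2Hi WitnessRow.R3
    have hs3 : (0 : ℝ) < (r.s : ℝ) ^ 3 := by positivity
    have h4 : (4 : ℝ) ^ (-(3 / 2 : ℝ)) = 1 / 8 := by
      rw [Real.rpow_neg (by norm_num), show (4 : ℝ) = 2 ^ (2 : ℝ) by norm_num, ← Real.rpow_mul (by norm_num)]
      norm_num
    have hR2 : (0 : ℝ) ≤ r.R2 := by
      -- R₂ (π/2a)^{3/2} = ∫ (non-negative) ≥ 0
      have h0 : 0 ≤ ∫ y, QPoly.eval wResid y * ⟪evalVec r.g1 y, evalVec r.g1 y⟫ * gauss ((2 * r.a : ℚ) : ℝ) y :=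
        integral_nonneg fun y => by
          rw [eval_wResid, real_inner_self_eq_norm_sq]
          have := gauss_pos (((2 * r.a : ℚ) : ℝ)) y
          positivity
      rw [hI2] at h0
      have hpos : (0 : ℝ) < (Real.pi / ((2 * r.a : ℚ) : ℝ)) ^ (3 / 2 : ℝ) := by
        apply Real.rpow_pos_of_pos; push_cast; rw [haR]; unfold WitnessRow.aR; positivity
      exact nonneg_of_mul_nonneg_right (by rwa [mul_comm] at h0) hpos
    have hR4 : (0 : ℝ) ≤ r.R4 := by
      have h0 : 0 ≤ ∫ y, QPoly.eval wResid y * ⟪evalVec r.g2 y, evalVec r.g2 y⟫ * gauss ((4 * r.a : ℚ) : ℝ) y :=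
        integral_nonneg fun y => by
          rw [eval_wResid, real_inner_self_eq_norm_sq]
          have := gauss_pos (((4 * r.a : ℚ) : ℝ)) y
          positivity
      rw [hI4] at h0
      have hpos : (0 : ℝ) < (Real.pi / ((4 * r.a : ℚ) : ℝ)) ^ (3 / 2 : ℝ) := by
        apply Real.rpow_pos_of_pos; push_cast; rw [haR]; unfold WitnessRow.aR; positivity
      exact nonneg_of_mul_nonneg_right (by rwa [mul_comm] at h0) hpos
    push_cast
    rw [h4]
    have hdist : ∀ x y z : ℝ, (pi32Hi : ℝ) / (r.s : ℝ) ^ 3 * (x + y + z) =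
        (pi32Hi : ℝ) / (r.s : ℝ) ^ 3 * x + (pi32Hi : ℝ) / (r.s : ℝ) ^ 3 * y + (pi32Hi : ℝ) / (r.s : ℝ) ^ 3 * z :=
      fun x y z => by ring
    rw [hdist]
    have t1 : (r.R2 : ℝ) * (Real.pi ^ (3 / 2 : ℝ) * (2 : ℝ) ^ (-(3 / 2 : ℝ)) / (r.s : ℝ) ^ 3) ≤
        (pi32Hi : ℝ) / (r.s : ℝ) ^ 3 * ((r.R2 : ℝ) * c2Hi) := by
      rw [show (pi32Hi : ℝ) / (r.s : ℝ) ^ 3 * ((r.R2 : ℝ) * c2Hi) =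
        (r.R2 : ℝ) * ((pi32Hi : ℝ) * (c2Hi : ℝ) / (r.s : ℝ) ^ 3) by ring]
      refine mul_le_mul_of_nonneg_left (div_le_div_of_nonneg_right ?_ hs3.le) hR2
      exact mul_le_mul hpiH hc2H (by positivity) (by norm_num [pi32Hi])
    have t3 : (r.R4 : ℝ) * (Real.pi ^ (3 / 2 : ℝ) * (1 / 8) / (r.s : ℝ) ^ 3) ≤
        (pi32Hi : ℝ) / (r.s : ℝ) ^ 3 * ((r.R4 : ℝ) / 8) := by
      rw [show (pi32Hi : ℝ) / (r.s : ℝ) ^ 3 * ((r.R4 : ℝ) / 8) =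
        (r.R4 : ℝ) * ((pi32Hi : ℝ) * (1 / 8) / (r.s : ℝ) ^ 3) by ring]
      refine mul_le_mul_of_nonneg_left (div_le_div_of_nonneg_right ?_ hs3.le) hR4
      exact mul_le_mul_of_nonneg_right hpiH (by norm_num)
    split_ifs with hR3
    · push_cast
      have hpv : (0 : ℝ) ≤ (pairVec wResid r.g1 r.g2 (3 * r.a) : ℝ) := by
        have : (0 : ℚ) ≤ pairVec wResid r.g1 r.g2 (3 * r.a) := by linarith
        exact_mod_cast this
      have t2 : 2 * ((pairVec wResid r.g1 r.g2 (3 * r.a) : ℝ) *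
            (Real.pi ^ (3 / 2 : ℝ) * (3 : ℝ) ^ (-(3 / 2 : ℝ)) / (r.s : ℝ) ^ 3)) ≤
          (pi32Hi : ℝ) / (r.s : ℝ) ^ 3 * (2 * (pairVec wResid r.g1 r.g2 (3 * r.a) : ℝ) * c3Hi) := by
        rw [show (pi32Hi : ℝ) / (r.s : ℝ) ^ 3 * (2 * (pairVec wResid r.g1 r.g2 (3 * r.a) : ℝ) * c3Hi) =
          2 * ((pairVec wResid r.g1 r.g2 (3 * r.a) : ℝ) * ((pi32Hi : ℝ) * (c3Hi : ℝ) / (r.s : ℝ) ^ 3)) by ring]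
        refine mul_le_mul_of_nonneg_left (mul_le_mul_of_nonneg_left (div_le_div_of_nonneg_right ?_ hs3.le) hpv)
          (by norm_num)
        exact mul_le_mul hpiH hc3H (by positivity) (by norm_num [pi32Hi])
      exact add_le_add (add_le_add t1 t2) t3
    · push_cast
      have hpv : (pairVec wResid r.g1 r.g2 (3 * r.a) : ℝ) ≤ 0 := by
        have : pairVec wResid r.g1 r.g2 (3 * r.a) ≤ (0 : ℚ) := by push Not at hR3; linarith
        exact_mod_cast this
      -- negative cross term: the PRODUCT lower bound `pi32Hi·c3Lo ≤ π^{3/2}·3^{−3/2}`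
      have t2 : 2 * ((pairVec wResid r.g1 r.g2 (3 * r.a) : ℝ) *
            (Real.pi ^ (3 / 2 : ℝ) * (3 : ℝ) ^ (-(3 / 2 : ℝ)) / (r.s : ℝ) ^ 3)) ≤
          (pi32Hi : ℝ) / (r.s : ℝ) ^ 3 * (2 * (pairVec wResid r.g1 r.g2 (3 * r.a) : ℝ) * c3Lo) := by
        rw [show (pi32Hi : ℝ) / (r.s : ℝ) ^ 3 * (2 * (pairVec wResid r.g1 r.g2 (3 * r.a) : ℝ) * c3Lo) =
          2 * ((pairVec wResid r.g1 r.g2 (3 * r.a) : ℝ) * ((pi32Hi : ℝ) * (c3Lo : ℝ) / (r.s : ℝ) ^ 3)) by ring]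
        refine mul_le_mul_of_nonneg_left (mul_le_mul_of_nonpos_left (div_le_div_of_nonneg_right hprod hs3.le) hpv)
          (by norm_num)
      exact add_le_add (add_le_add t1 t2) t3

end Summit.NavierStokesRegularity.NavierStokesRegularity.Cruxes.ScarEnvelopeTypeI.ForcedTsai

end
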